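import Literature.AlgebraicGeometry.HodgeTheory.NodalPencilModelIsotopy
import Literature.AlgebraicGeometry.HodgeTheory.CyclicCoverPencilModelIsotopy
import Literature.AlgebraicGeometry.HodgeTheory.CyclicCoverPencilModelIsotopyContinuity
import Literature.AlgebraicGeometry.Motives.UniversalHypersurfaceRegularLocusChartTarget
import Literature.Geometry.ComplexAnalytic.PhamBrieskornWeightedRotation
import HarnessLib

/-!
# The model isotopy of a monomial pencil near an isolated singular point of Pham–Brieskorn type (arbitrary weights):
# coordinates, pencil coordinate, chart radius, flow law, good set

Family `hodge`, layer `Literature/AlgebraicGeometry/HodgeTheory`; theorems only (no definition, no named fact). Written by the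
prover seat `hodge-nonav-20241-p1` (g19, cell `hodge-nonav`) as brick 3 of the port B4c of the programme «A₃-TRACE» (memo
`HOME/memos/PROGRAMME-A3-TRACE-Bx-g16.md` §3; binder hN `stub_a3NonComm` of crux K1-B `VeryGeneralSignCommutatorsInHg`,
stmt-HodgeConjecture-19716): the WEIGHTED twin of prover-Bx's `NodalPencilModelIsotopy` (all weights `2`). For a weight vector
`a : Fin (n + 1) → ℕ` (all `aⱼ ≠ 0`) and a chart `Θ` of `ℂⁿ⁺¹` with `Σⱼ (Θ y)ⱼ^{aⱼ} = φ(y)` on its source (`φ(y)` = the solved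
coefficient of `xᵢ^d` at `(b'₀, y)` minus `(b₀)_{xᵢ^d}`), the model isotopy
`J(θ, x) = chartModelIsotopy a Φ Θ θ x = Φ⁻¹(b'(x), Θ⁻¹ R_θ Θ y(x))` (`CyclicCoverPencilModelIsotopy`, prover-Ax, generic in `a`) rotates
the chart coordinate `j` by `e^{iθ/aⱼ}` (Milnor's weighted rotation, `Geometry/ComplexAnalytic/PhamBrieskornWeightedRotation`), so
`J(2π, ·)` reads `(e^{2πi/aⱼ} zⱼ)ⱼ` in the chart — the monodromy of the Pham–Brieskorn model `Σ zⱼ^{aⱼ}` (at a node: the antipodal map;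
at an `A₃` point, `a = (2, …, 2, 4)`: `(−z₀, …, −z_{n−1}, i·zₙ)`).

For a slice point `x` in the chart with `y(x)` in the chart ball `{Σ|Θ y|² < r²}` (`{Σ|z|² ≤ r²} ⊆ Θ.target`) and pencil coordinate
`0 < |c(x)| < ρW`, assuming the members `b₀ + c'·e_{xᵢ^d}`, `0 < |c'| < ρW`, nonsingular (statements and proofs VERBATIM those of the
nodal file with `2 ↦ aⱼ`; `NodalPencil.regChartCoeffVec_slice_eq`, `pencilSlice`, `pencilCoord`, `satRadius` reused):
* `phi_rotated_eq` — `φ(Θ⁻¹ R_θ Θ y(x)) = e^{iθ} c(x)`;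
* `chartModelIsotopy_slice_spec` — `J(θ, x) ∈ Φ.source` with chart coordinates `(b'₀, Θ⁻¹ R_θ Θ y(x))`;
  `chartModelIsotopy_mem_pencilSlice`, `affine_chartModelIsotopy`, `pencilCoord_chartModelIsotopy` (`= e^{iθ} c(x)`),
  `sum_norm_sq_chartModelIsotopy` (same chart radius), `satRadius_chartModelIsotopy`, `chartModelIsotopy_add` (flow law),
  `mem_goodSet_of_satRadius_lt` (slice points with `F < R₀ ≤ min R''' r²` and `0 < |c| < ρW` lie in the continuity set of
  `CyclicCoverPencilModelIsotopyContinuity.continuousOn_chartModelIsotopy`).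

Everything is proved; no definitions, no named facts. Honest scope: plumbing of the classical construction of the geometric monodromy of a
pencil near an isolated weighted-homogeneous singular point; nothing here says HC or any rung is proved.

## References

* [Milnor1968] J. Milnor, Singular Points of Complex Hypersurfaces (1968), §9 Lemma 9.4 (the model monodromy `z ↦ e^{iθ/aⱼ} z`), p. 77.
* [ArnoldGuseinzadeVarchenko2012] V. I. Arnold, S. M. Gusein-Zade, A. N. Varchenko, Singularities of Differentiable Maps II (2012),
  Part I §1.1, §2.3.
-/

noncomputable section

open MvPolynomial Set Function Complex
open Literature.AlgebraicGeometry.Motives Literature.AlgebraicGeometry.Motives.UniversalHypersurface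
open Literature.AlgebraicGeometry.HodgeTheory.UniversalHypersurface Literature.Geometry.ComplexAnalytic

namespace Literature.AlgebraicGeometry.HodgeTheory

namespace WeightedPencil

open NodalPencil

section Spec

variable {n d : ℕ} {i : Fin (n + 2)} (a : Fin (n + 1) → ℕ) (ha : ∀ j, a j ≠ 0) (hd : 0 < d) (b₀ : DegIndex n d → ℂ)
  (Φ : OpenPartialHomeomorph (ComplexPoints (regularTotal ℂ n d)) (({m : DegIndex n d // m ≠ regPowIndex n d i} ⊕ Fin (n + 1)) → ℂ))
  (hΦ : ⇑Φ = regChartFun n d i) (hΦs : Φ.source = regChartDom n d i) (hΦt : Φ.target = regChartFun n d i '' regChartDom n d i)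
  (Θ : OpenPartialHomeomorph (Fin (n + 1) → ℂ) (Fin (n + 1) → ℂ)) {r : ℝ}
  (hr : {z : Fin (n + 1) → ℂ | ∑ j, ‖z j‖ ^ 2 ≤ r ^ 2} ⊆ Θ.target)
  (φ : (Fin (n + 1) → ℂ) → ℂ)
  (hφ : ∀ y, φ y = regChartCoeffVec n d i
    (Sum.elim (fun m : {m : DegIndex n d // m ≠ regPowIndex n d i} => b₀ m.1) y) (regPowIndex n d i) - b₀ (regPowIndex n d i))
  (hΘφ : ∀ y ∈ Θ.source, ∑ j, (Θ y j) ^ a j = φ y)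
  {ρW : ℝ}
  (hns : ∀ c : ℂ, c ≠ 0 → ‖c‖ < ρW →
    SmoothHypersurface.IsNonsingularForm ℂ (formOfCoeffs (b₀ + Pi.single (regPowIndex n d i) c)))
  {x : ComplexPoints (regularTotal ℂ n d)} (hx : x ∈ Φ.source) (hb : x ∈ pencilSlice n d i b₀)
  (hy : (fun j => regChartFun n d i x (Sum.inr j)) ∈ Θ.source)
  (hyr : ∑ j, ‖Θ (fun j => regChartFun n d i x (Sum.inr j)) j‖ ^ 2 < r ^ 2)
  (hc0 : pencilCoord n d i b₀ x ≠ 0) (hcρ : ‖pencilCoord n d i b₀ x‖ < ρW) (θ : ℝ)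
include ha hd hΦ hΦs hΦt hr hφ hΘφ hns hx hb hy hyr hc0 hcρ

omit hd hΦ hΦt hns hc0 hcρ in
/-- The rotated affine coordinates have pencil value `e^{iθ} c(x)`. [cite: Milnor1968, §9 Lemma 9.4] -/
theorem phi_rotated_eq :
    φ (Θ.symm (fun k => Complex.exp (((θ / a k : ℝ) : ℂ) * I) *
        Θ (fun j => regChartFun n d i x (Sum.inr j)) k)) =
      Complex.exp ((θ : ℂ) * I) * pencilCoord n d i b₀ x := by
  have hxd : x ∈ regChartDom n d i := hΦs ▸ hx
  have h1 := PhamBrieskorn.apply_modelIsotopy_eq_exp_mul a Θ ha hr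
    (φ := φ) (fun y hy => hΘφ y hy) hy hyr θ
  rw [pencilCoord_eq_phi n d i b₀ φ hφ hxd hb]
  exact h1

/-- **`J(θ, x)` lies in the chart domain with chart coordinates `(b'₀, Θ⁻¹ R_θ Θ y(x))`.** [cite: Milnor1968, §9 Lemma 9.4] -/
theorem chartModelIsotopy_slice_spec :
    chartModelIsotopy a Φ Θ θ x ∈ Φ.source ∧
      Φ (chartModelIsotopy a Φ Θ θ x) =
        Sum.elim (fun m => Φ x (Sum.inl m))
          (Θ.symm (fun k => Complex.exp (((θ / a k : ℝ) : ℂ) * I) *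
            Θ (fun j => Φ x (Sum.inr j)) k)) := by
  have h := chartModelIsotopy_mem_and_apply a Φ Θ hd hΦt hx (θ := θ) ?_
  · exact h
  -- the solved form at the rotated coordinates is the pencil member over `e^{iθ} c`
  have hb' : (fun m : {m : DegIndex n d // m ≠ regPowIndex n d i} => Φ x (Sum.inl m)) =
      fun m => b₀ m.1 := by
    funext m; rw [hΦ]; exact hb m
  rw [hb', hΦ, regChartCoeffVec_slice_eq b₀ φ hφ, phi_rotated_eq a ha b₀ Φ hΦs Θ hr φ hφ hΘφ hx hb hy hyr θ]
  refine hns _ (mul_ne_zero (Complex.exp_ne_zero _) hc0) ?_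
  rw [norm_mul, Complex.norm_exp_ofReal_mul_I, one_mul]; exact hcρ

/-- **`J(θ, x)` stays in the pencil slice.** [cite: Milnor1968, §9 Lemma 9.4] -/
theorem chartModelIsotopy_mem_pencilSlice :
    chartModelIsotopy a Φ Θ θ x ∈ pencilSlice n d i b₀ := fun m => by
  obtain ⟨-, hJ⟩ := chartModelIsotopy_slice_spec a ha hd b₀ Φ hΦ hΦs hΦt Θ hr φ hφ hΘφ hns hx hb hy hyr hc0 hcρ θ
  have h := congrFun hJ (Sum.inl m)
  rw [hΦ] at h
  change regCoeff ℂ n d _ m.1 = regCoeff ℂ n d x m.1 at h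
  rw [h]; exact hb m

/-- **The affine coordinates of `J(θ, x)` are the rotated ones.** [cite: Milnor1968, §9 Lemma 9.4] -/
theorem affine_chartModelIsotopy :
    (fun j => regChartFun n d i (chartModelIsotopy a Φ Θ θ x) (Sum.inr j)) =
      Θ.symm (fun k => Complex.exp (((θ / a k : ℝ) : ℂ) * I) *
        Θ (fun j => regChartFun n d i x (Sum.inr j)) k) := by
  obtain ⟨-, hJ⟩ := chartModelIsotopy_slice_spec a ha hd b₀ Φ hΦ hΦs hΦt Θ hr φ hφ hΘφ hns hx hb hy hyr hc0 hcρ θ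
  funext j
  have h := congrFun hJ (Sum.inr j)
  rw [hΦ] at h
  exact h

/-- **The pencil coordinate of `J(θ, x)` is `e^{iθ} c(x)`.** [cite: Milnor1968, §9 Lemma 9.4] -/
theorem pencilCoord_chartModelIsotopy :
    pencilCoord n d i b₀ (chartModelIsotopy a Φ Θ θ x) =
      Complex.exp ((θ : ℂ) * I) * pencilCoord n d i b₀ x := by
  obtain ⟨hJs, -⟩ := chartModelIsotopy_slice_spec a ha hd b₀ Φ hΦ hΦs hΦt Θ hr φ hφ hΘφ hns hx hb hy hyr hc0 hcρ θ
  have hJd : chartModelIsotopy a Φ Θ θ x ∈ regChartDom n d i := hΦs ▸ hJs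
  rw [pencilCoord_eq_phi n d i b₀ φ hφ hJd
    (chartModelIsotopy_mem_pencilSlice a ha hd b₀ Φ hΦ hΦs hΦt Θ hr φ hφ hΘφ hns hx hb hy hyr hc0 hcρ θ),
    affine_chartModelIsotopy a ha hd b₀ Φ hΦ hΦs hΦt Θ hr φ hφ hΘφ hns hx hb hy hyr hc0 hcρ θ]
  exact phi_rotated_eq a ha b₀ Φ hΦs Θ hr φ hφ hΘφ hx hb hy hyr θ

/-- **The Morse radius of `J(θ, x)` equals that of `x`** (and its affine coordinates lie in `Θ.source`). [cite: Milnor1968, §9 Lemma 9.4] -/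
theorem sum_norm_sq_chartModelIsotopy :
    (fun j => regChartFun n d i (chartModelIsotopy a Φ Θ θ x) (Sum.inr j)) ∈ Θ.source ∧
      ∑ k, ‖Θ (fun j => regChartFun n d i (chartModelIsotopy a Φ Θ θ x) (Sum.inr j)) k‖ ^ 2 =
        ∑ k, ‖Θ (fun j => regChartFun n d i x (Sum.inr j)) k‖ ^ 2 := by
  obtain ⟨hmem, happ, -⟩ := PhamBrieskorn.modelIsotopy_mem a Θ hr hyr θ
  rw [affine_chartModelIsotopy a ha hd b₀ Φ hΦ hΦs hΦt Θ hr φ hφ hΘφ hns hx hb hy hyr hc0 hcρ θ]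
  refine ⟨hmem, ?_⟩
  rw [happ]
  simp_rw [norm_mul, Complex.norm_exp_ofReal_mul_I, one_mul]

/-- **The model isotopy preserves the saturated Morse radius** (`R''' < R''`, `Σ|Θ y(x)|² ≤ R'''`).
[cite: ArnoldGuseinzadeVarchenko2012, Part I §1.1] [cite: Milnor1968, §9 Lemma 9.4] -/
theorem satRadius_chartModelIsotopy {R''' R'' : ℝ} (hR : R''' < R'')
    (hyR : ∑ k, ‖Θ (fun j => regChartFun n d i x (Sum.inr j)) k‖ ^ 2 ≤ R''') :
    satRadius n d i Θ R''' R'' (chartModelIsotopy a Φ Θ θ x) = satRadius n d i Θ R''' R'' x := by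
  obtain ⟨hJs, -⟩ := chartModelIsotopy_slice_spec a ha hd b₀ Φ hΦ hΦs hΦt Θ hr φ hφ hΘφ hns hx hb hy hyr hc0 hcρ θ
  obtain ⟨hyJ, hSigJ⟩ := sum_norm_sq_chartModelIsotopy a ha hd b₀ Φ hΦ hΦs hΦt Θ hr φ hφ hΘφ hns hx hb hy hyr hc0 hcρ θ
  have hJd : chartModelIsotopy a Φ Θ θ x ∈ regChartDom n d i := hΦs ▸ hJs
  have hxd : x ∈ regChartDom n d i := hΦs ▸ hx
  rw [satRadius_eq_of_le n d i Θ R''' R'' hR hJd hyJ (hSigJ ▸ hyR), satRadius_eq_of_le n d i Θ R''' R'' hR hxd hy hyR, hSigJ]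

/-- **Flow law of the model isotopy** at the good points. [cite: Milnor1968, §9 Lemma 9.4] -/
theorem chartModelIsotopy_add (θ' : ℝ) :
    chartModelIsotopy a Φ Θ (θ' + θ) x =
      chartModelIsotopy a Φ Θ θ'
        (chartModelIsotopy a Φ Θ θ x) := by
  set x' := chartModelIsotopy a Φ Θ θ x with hx'def
  obtain ⟨hx's, hΦx'⟩ := chartModelIsotopy_slice_spec a ha hd b₀ Φ hΦ hΦs hΦt Θ hr φ hφ hΘφ hns hx hb hy hyr hc0 hcρ θ
  have hA := affine_chartModelIsotopy a ha hd b₀ Φ hΦ hΦs hΦt Θ hr φ hφ hΘφ hns hx hb hy hyr hc0 hcρ θ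
  have hB : (fun m : {m : DegIndex n d // m ≠ regPowIndex n d i} => Φ x' (Sum.inl m)) = fun m => Φ x (Sum.inl m) := by
    funext m; exact congrFun hΦx' (Sum.inl m)
  rw [chartModelIsotopy_of_mem _ Φ Θ hx, chartModelIsotopy_of_mem _ Φ Θ hx's, hB]
  congr 1
  funext s
  rcases s with m | j
  · rfl
  · simp only [Sum.elim_inr]
    have hA' : (fun j => Φ x' (Sum.inr j)) =
        Θ.symm (fun k => Complex.exp (((θ / a k : ℝ) : ℂ) * I) *
          Θ (fun j => regChartFun n d i x (Sum.inr j)) k) := by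
      rw [hΦ]; exact hA
    rw [hA', hΦ]
    have hadd := congrFun (PhamBrieskorn.modelIsotopy_add a Θ hr hyr θ' θ) j
    exact hadd

end Spec

/-- **Good points lie in the continuity set of the model isotopy**: a slice point with `F(x) < R₀ ≤ min R''' r²` (`R''' < R''`) and
`0 < |c(x)| < ρW` belongs to the set on which `continuousOn_chartModelIsotopy` gives joint continuity. [cite: Milnor1968, §9 Lemma 9.4] -/
theorem mem_goodSet_of_satRadius_lt {n d : ℕ} {i : Fin (n + 2)} (a : Fin (n + 1) → ℕ) (ha : ∀ j, a j ≠ 0) (hd : 0 < d)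
    (b₀ : DegIndex n d → ℂ)
    (Φ : OpenPartialHomeomorph (ComplexPoints (regularTotal ℂ n d)) (({m : DegIndex n d // m ≠ regPowIndex n d i} ⊕ Fin (n + 1)) → ℂ))
    (hΦ : ⇑Φ = regChartFun n d i) (hΦs : Φ.source = regChartDom n d i) (hΦt : Φ.target = regChartFun n d i '' regChartDom n d i)
    (Θ : OpenPartialHomeomorph (Fin (n + 1) → ℂ) (Fin (n + 1) → ℂ)) {r R₀ R''' R'' : ℝ}
    (hr : {z : Fin (n + 1) → ℂ | ∑ j, ‖z j‖ ^ 2 ≤ r ^ 2} ⊆ Θ.target)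
    (φ : (Fin (n + 1) → ℂ) → ℂ)
    (hφ : ∀ y, φ y = regChartCoeffVec n d i
      (Sum.elim (fun m : {m : DegIndex n d // m ≠ regPowIndex n d i} => b₀ m.1) y) (regPowIndex n d i) - b₀ (regPowIndex n d i))
    (hΘφ : ∀ y ∈ Θ.source, ∑ j, (Θ y j) ^ a j = φ y)
    {ρW : ℝ}
    (hns : ∀ c : ℂ, c ≠ 0 → ‖c‖ < ρW →
      SmoothHypersurface.IsNonsingularForm ℂ (formOfCoeffs (b₀ + Pi.single (regPowIndex n d i) c)))
    (hR : R''' < R'') (hR₀ : R₀ ≤ R''') (hR₀r : R₀ ≤ r ^ 2)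
    {x : ComplexPoints (regularTotal ℂ n d)} (hb : x ∈ pencilSlice n d i b₀)
    (hF : satRadius n d i Θ R''' R'' x < R₀) (hc0 : pencilCoord n d i b₀ x ≠ 0) (hcρ : ‖pencilCoord n d i b₀ x‖ < ρW) :
    x ∈ Φ.source ∧ (fun j => Φ x (Sum.inr j)) ∈ Θ.source ∧ ∑ k, ‖Θ (fun j => Φ x (Sum.inr j)) k‖ ^ 2 < r ^ 2 ∧
      ∀ θ : ℝ, (Sum.elim (fun m => Φ x (Sum.inl m))
        (Θ.symm (fun k => Complex.exp (((θ / a k : ℝ) : ℂ) * I) *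
          Θ (fun j => Φ x (Sum.inr j)) k)) :
            ({m : DegIndex n d // m ≠ regPowIndex n d i} ⊕ Fin (n + 1)) → ℂ) ∈ Φ.target := by
  obtain ⟨hxd, hy, hSig⟩ := mem_of_satRadius_lt n d i Θ R''' R'' hR (lt_of_lt_of_le hF hR₀)
  have hx : x ∈ Φ.source := hΦs ▸ hxd
  have hyr : ∑ k, ‖Θ (fun j => regChartFun n d i x (Sum.inr j)) k‖ ^ 2 < r ^ 2 := by
    rw [hSig]; exact lt_of_lt_of_le hF hR₀r
  refine ⟨hx, by rw [hΦ]; exact hy, by rw [hΦ]; exact hyr, fun θ => ?_⟩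
  obtain ⟨hJs, hJ⟩ := chartModelIsotopy_slice_spec a ha hd b₀ Φ hΦ hΦs hΦt Θ hr φ hφ hΘφ hns hx hb hy hyr hc0 hcρ θ
  rw [← hJ]
  exact Φ.map_source hJs

end WeightedPencil

end Literature.AlgebraicGeometry.HodgeTheory

end
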